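import Literature.Geometry.Lorentzian.NomizuKillingExtension
import Literature.Geometry.Lorentzian.KillingChartAnalyticExtension
import Literature.Geometry.Lorentzian.ExtChartKillingTransfer
import Literature.Topology.CoveringSpaces.SheafMonodromyExtension
import Mathlib.Topology.Algebra.Module.LocallyConvex
import HarnessLib

/-!
# Proof of Nomizu's extension theorem for Killing fields (`Nomizu1960_killing_extension`)

Discharge (`Nomizu1960_killing_extension_holds`) of the named fact
`PseudoRiemannianMetric.Nomizu1960_killing_extension` of the sibling file
`NomizuKillingExtension.lean`: K. Nomizu, *On local and global existence of Killing vector fields*,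
Ann. of Math. (2) 72 (1960) 105–120, Theorems 1–2, in the pseudo-Riemannian form printed as
Theorem 2.1 of P. T. Chruściel, *On rigidity of analytic black holes*, Commun. Math. Phys. 189
(1997) 1–7 (arXiv:gr-qc/9610011, p. 5 of the arXiv version, with the footnote "all the assertions
and proofs of [Nomizu] remain valid word for word when 'Riemannian' is replaced by
'pseudo-Riemannian'"): on a simply connected real-analytic pseudo-Riemannian manifold (here: any
signature, a model with corners allowed but the manifold without boundary) a Killing field given on
a connected open subset extends to a global Killing field.

Chruściel prints no proof; the proof formalised here is Nomizu's analytic continuation, organised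
as in Kobayashi–Nomizu I, Ch. VI, §6 (Thm. 6.1 with its Lemmas 1–4, and the factorization lemma of
Appendix 7 for the independence of the path), in three layers:

1. **the analysis in a chart** (`KillingChartAnalyticExtension.lean`): the `1`-jet `(X, DX)` of a
   solution of the coordinate Killing equation satisfies along every segment a linear system with
   coefficients real-analytic in the point (the prolongation `∇∇ξ = R ξ`, Wald (C.3.6), solved for
   `D²X`); solving it along the rays of a chart ball from the jet at one point, real-analytically in
   the endpoint (Poincaré–Lang analytic dependence on parameters,
   `Literature/Analysis/ODE/AnalyticParametricLinear.lean`), produces an analytic field which agrees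
   with the given one near the centre and whose Killing expression — analytic, zero near the
   centre — vanishes on the ball (identity theorem): Nomizu's Theorem 1 in a chart; with the unique
   continuation of Killing solutions (`KillingChartJetRigidity.lean`);
2. **the transfer to the manifold** (`ExtChartKillingTransfer.lean`): local Killing fields of the
   `C^ω` metric read in an extended chart are `C^∞` solutions of the coordinate Killing equation of
   the (analytic) chart representative of the metric, and conversely (naturality of the Levi-Civita
   connection under the local isometry `φ⁻¹`); whence unique continuation on `M`
   (`killing_eqOn_of_eventuallyEq`) and Nomizu's Theorem 1 on `M` (`exists_killing_extension_nhds`: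
   every point has a preconnected open neighbourhood `W` over which every Killing germ at a point of
   `W` extends);
3. **the monodromy argument** (`Literature/Topology/CoveringSpaces/SheafMonodromyExtension.lean`):
   for a sheaf of functions with unique continuation and this local extension property on a simply
   connected, locally path connected space, sections over connected open sets extend globally (the
   étalé space of germs is a covering space; Mathlib's
   `IsCoveringMap.existsUnique_continuousMap_lifts`).

Everything is proved; no definitions, no named facts (D-0026).

## References

* K. Nomizu, Ann. of Math. (2) 72 (1960) 105–120, Theorems 1–2. [Nomizu1960]
* P. T. Chruściel, Commun. Math. Phys. 189 (1997) 1–7, Thm. 2.1 and footnote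
  (arXiv:gr-qc/9610011). [Chrusciel1997]
* S. Kobayashi, K. Nomizu, *Foundations of Differential Geometry* I (1963), Ch. VI §6, Thm. 6.1,
  Lemmas 1–4; Appendix 7. [KobayashiNomizu1963]
* B. O'Neill, *Semi-Riemannian geometry* (1983), Ch. 9, Prop. 9.25, Lemma 9.28. [ONeill1983]
-/

noncomputable section

open Bundle Set Function Filter TopologicalSpace VectorField Metric
open Literature.Geometry.Manifold (ExtRechart)
open scoped Manifold ContDiff Topology

namespace Literature.Geometry.Lorentzian

namespace PseudoRiemannianMetric

universe u v w

section NomizuProof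

variable {E : Type u} [NormedAddCommGroup E] [NormedSpace ℝ E] [FiniteDimensional ℝ E]
  {H : Type v} [TopologicalSpace H] {I : ModelWithCorners ℝ E H}
  {M : Type w} [TopologicalSpace M] [ChartedSpace H M] [IsManifold I ω M] [BoundarylessManifold I M]
  (g : PseudoRiemannianMetric I ω E (TangentSpace I : M → Type _)) [g.HasLeviCivita]

/-! ### The chart data at a point -/

omit [g.HasLeviCivita] in
/-- **Chart data at a point.** At `x₀ ∈ M` there are a representative `G` of `g` in the extended
chart at `x₀` and a ball `B_r(φ x₀)` inside the chart target on which `G` is real-analytic,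
symmetric and nondegenerate (`ExtChartKilling.contDiffAt_repr`, `repr_symm`, `repr_nondegenerate`).
[folklore] -/
theorem exists_chart_ball (x₀ : M) :
    ∃ (G : E → E →L[ℝ] E →L[ℝ] ℝ) (r : ℝ), 0 < r ∧
      ball (extChartAt I x₀ x₀) r ⊆ (extChartAt I x₀).target ∧
      (∀ (p : (⟨(extChartAt I x₀).target, ExtRechart.isOpen_extChartAt_target x₀⟩ : Opens E))
        (a b : E), G p a b = g.val ((extChartAt I x₀).symm p)
          (mfderiv 𝓘(ℝ, E) I (fun p : (⟨(extChartAt I x₀).target,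
            ExtRechart.isOpen_extChartAt_target x₀⟩ : Opens E) ↦ (extChartAt I x₀).symm (p : E))
            p a)
          (mfderiv 𝓘(ℝ, E) I (fun p : (⟨(extChartAt I x₀).target,
            ExtRechart.isOpen_extChartAt_target x₀⟩ : Opens E) ↦ (extChartAt I x₀).symm (p : E))
            p b)) ∧
      ContDiffOn ℝ ω G (ball (extChartAt I x₀ x₀) r) ∧
      (∀ z ∈ ball (extChartAt I x₀ x₀) r, ∀ a b : E, G z a b = G z b a) ∧
      (∀ z ∈ ball (extChartAt I x₀ x₀) r, ∀ a : E, (∀ b, G z a b = 0) → a = 0) := by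
  obtain ⟨G, hG⟩ := ExtChartKilling.exists_repr g x₀
  obtain ⟨r, hr, hsub⟩ := Metric.isOpen_iff.mp (ExtRechart.isOpen_extChartAt_target (I := I) x₀)
    (extChartAt I x₀ x₀) (mem_extChartAt_target x₀)
  refine ⟨G, r, hr, hsub, hG, fun z hz ↦ ?_, fun z hz a b ↦ ?_, fun z hz a h ↦ ?_⟩
  · exact (ExtChartKilling.contDiffAt_repr g hG ⟨z, hsub hz⟩).contDiffWithinAt
  · exact ExtChartKilling.repr_symm g hG ⟨z, hsub hz⟩ a b
  · exact ExtChartKilling.repr_nondegenerate g hG ⟨z, hsub hz⟩ a h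

/-! ### Down: a local Killing field read on a chart ball -/

/-- **A local Killing field read on a chart ball.** For the chart data `G` at `x₀` and a field `f`,
`C^∞` and Killing for `g` on an open set `U`, and a ball `B` of the chart target with
`φ⁻¹(B) ⊆ U`, the chart representative `X = Ψ^* f` of `f` is a `C²` solution of the coordinate
Killing equation of `G` on `B` (`ExtChartKilling.coordKilling_of_killingOn`). [folklore] -/
theorem exists_coord_solution {x₀ : M} {G : E → E →L[ℝ] E →L[ℝ] ℝ}
    (hG : ∀ (p : (⟨(extChartAt I x₀).target, ExtRechart.isOpen_extChartAt_target x₀⟩ : Opens E))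
      (a b : E), G p a b = g.val ((extChartAt I x₀).symm p)
        (mfderiv 𝓘(ℝ, E) I (fun p : (⟨(extChartAt I x₀).target,
          ExtRechart.isOpen_extChartAt_target x₀⟩ : Opens E) ↦ (extChartAt I x₀).symm (p : E))
          p a)
        (mfderiv 𝓘(ℝ, E) I (fun p : (⟨(extChartAt I x₀).target,
          ExtRechart.isOpen_extChartAt_target x₀⟩ : Opens E) ↦ (extChartAt I x₀).symm (p : E))
          p b))
    {f : Π x : M, TangentSpace I x} {U : Set M} (hU : IsOpen U)
    (hfs : ContMDiffOn I I.tangent ∞ (fun x ↦ (TotalSpace.mk' E x (f x) : TangentBundle I M)) U)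
    (hfK : ∀ x ∈ U, ∀ v w : TangentSpace I x,
      g.val x (g.leviCivita f x v) w + g.val x v (g.leviCivita f x w) = 0)
    {q : E} {ρ : ℝ} (hB : ball q ρ ⊆ (extChartAt I x₀).target)
    (hBU : ∀ z ∈ ball q ρ, (extChartAt I x₀).symm z ∈ U) :
    ∃ X : E → E,
      (∀ p : (⟨(extChartAt I x₀).target, ExtRechart.isOpen_extChartAt_target x₀⟩ : Opens E),
        X p = mpullback 𝓘(ℝ, E) I (fun p : (⟨(extChartAt I x₀).target,
          ExtRechart.isOpen_extChartAt_target x₀⟩ : Opens E) ↦ (extChartAt I x₀).symm (p : E))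
          f p) ∧
      ContDiffOn ℝ 2 X (ball q ρ) ∧
      ∀ z ∈ ball q ρ, ∀ a b : E,
        fderiv ℝ G z (X z) a b + G z (fderiv ℝ X z a) b + G z a (fderiv ℝ X z b) = 0 := by
  obtain ⟨X, hX⟩ := ExtChartKilling.exists_repr_field (x₀ := x₀) f
  refine ⟨X, hX, fun z hz ↦ ?_, fun z hz a b ↦ ?_⟩
  · have h := (ExtChartKilling.coordKilling_of_killingOn g hG hU hfs hfK hX ⟨z, hB hz⟩
      (hBU z hz)).1
    exact (h.of_le ENat.LEInfty.out).contDiffWithinAt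
  · exact (ExtChartKilling.coordKilling_of_killingOn g hG hU hfs hfK hX ⟨z, hB hz⟩
      (hBU z hz)).2 a b

/-! ### Unique continuation on `M` -/

/-- **Unique continuation of local Killing fields.** Two fields, `C^∞` and Killing for `g` on a
preconnected open set `U`, which agree near one point of `U` agree on `U`: the set where they
agree nearby is open, and closed in `U` because near any point of `U` the two fields, read in a
chart ball, are `C²` solutions of the coordinate Killing equation agreeing near a point, hence
equal (`KillingAnalyticChart.eqOn_of_eventuallyEq`). O'Neill 1983, Ch. 9, Lemma 9.28 ff.;
Kobayashi–Nomizu I, Ch. VI, Lemma 4 for Thm. 6.1. [cite: ONeill1983, Ch. 9, Lemma 9.28] -/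
theorem killing_eqOn_of_eventuallyEq {U : Set M} (hU : IsOpen U) (hUc : IsPreconnected U)
    {f₁ f₂ : Π x : M, TangentSpace I x}
    (h₁s : ContMDiffOn I I.tangent ∞ (fun x ↦ (TotalSpace.mk' E x (f₁ x) : TangentBundle I M)) U)
    (h₁K : ∀ x ∈ U, ∀ v w : TangentSpace I x,
      g.val x (g.leviCivita f₁ x v) w + g.val x v (g.leviCivita f₁ x w) = 0)
    (h₂s : ContMDiffOn I I.tangent ∞ (fun x ↦ (TotalSpace.mk' E x (f₂ x) : TangentBundle I M)) U)
    (h₂K : ∀ x ∈ U, ∀ v w : TangentSpace I x,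
      g.val x (g.leviCivita f₂ x v) w + g.val x v (g.leviCivita f₂ x w) = 0)
    {x : M} (hx : x ∈ U) (heq : f₁ =ᶠ[𝓝 x] f₂) : EqOn f₁ f₂ U := by
  let D : Set M := {y | f₁ =ᶠ[𝓝 y] f₂}
  have hDo : IsOpen D := isOpen_setOf_eventually_nhds
  have hsub : U ⊆ D := by
    refine hUc.subset_of_closure_inter_subset hDo ⟨x, hx, heq⟩ ?_
    rintro y ⟨hyc, hyU⟩
    -- chart data at `y`, and a chart ball over `U`
    obtain ⟨G, r, hr, hrt, hG, hGa, hGs, hGn⟩ := exists_chart_ball g y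
    have hSo : IsOpen ((extChartAt I y).target ∩ (extChartAt I y).symm ⁻¹' U) :=
      (contMDiffOn_extChartAt_symm (n := ω) y).continuousOn.isOpen_inter_preimage
        (ExtRechart.isOpen_extChartAt_target y) hU
    have hcS : extChartAt I y y ∈ (extChartAt I y).target ∩ (extChartAt I y).symm ⁻¹' U :=
      ⟨mem_extChartAt_target y, by rw [mem_preimage, extChartAt_to_inv]; exact hyU⟩
    obtain ⟨r₁, hr₁, hr₁S⟩ := Metric.isOpen_iff.mp hSo _ hcS
    have hρ : 0 < min r r₁ := lt_min hr hr₁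
    have hρr : ball (extChartAt I y y) (min r r₁) ⊆ ball (extChartAt I y y) r :=
      ball_subset_ball (min_le_left _ _)
    have hρt : ball (extChartAt I y y) (min r r₁) ⊆ (extChartAt I y).target := hρr.trans hrt
    have hρU : ∀ z ∈ ball (extChartAt I y y) (min r r₁), (extChartAt I y).symm z ∈ U :=
      fun z hz ↦ (hr₁S (ball_subset_ball (min_le_right _ _) hz)).2
    -- the two fields in the chart
    obtain ⟨X₁, hX₁, hX₁s, hX₁K⟩ := exists_coord_solution g hG hU h₁s h₁K hρt hρU
    obtain ⟨X₂, hX₂, hX₂s, hX₂K⟩ := exists_coord_solution g hG hU h₂s h₂K hρt hρU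
    -- a point of the chart neighbourhood of `y` near which the fields agree
    have hWo : IsOpen ((extChartAt I y).source ∩ extChartAt I y ⁻¹' ball (extChartAt I y y) (min
        r r₁)) :=
      isOpen_extChartAt_preimage' y isOpen_ball
    have hyW : y ∈ (extChartAt I y).source ∩ extChartAt I y ⁻¹' ball (extChartAt I y y) (min r
        r₁) :=
      ⟨mem_extChartAt_source y, mem_ball_self hρ⟩
    obtain ⟨z, hzW, hzD⟩ :
        ((extChartAt I y).source ∩ extChartAt I y ⁻¹' ball (extChartAt I y y) (min r r₁) ∩
            D).Nonempty := by
      rw [mem_closure_iff_nhds] at hyc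
      exact hyc _ (hWo.mem_nhds hyW)
    -- in the chart, the representatives agree near `φ z`
    have hqz : extChartAt I y z ∈ ball (extChartAt I y y) (min r r₁) := hzW.2
    have hev : X₁ =ᶠ[𝓝 (extChartAt I y z)] X₂ := by
      have hcont : ContinuousAt (extChartAt I y).symm (extChartAt I y z) :=
        continuousAt_extChartAt_symm'' (hρt hqz)
      have hz' : (extChartAt I y).symm (extChartAt I y z) = z := (extChartAt I y).left_inv hzW.1
      have h1 : ∀ᶠ p in 𝓝 (extChartAt I y z), f₁ ((extChartAt I y).symm p) =
          f₂ ((extChartAt I y).symm p) := by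
        have h : {y' | f₁ y' = f₂ y'} ∈ 𝓝 ((extChartAt I y).symm (extChartAt I y z)) := by
          rw [hz']
          exact hzD
        exact hcont.preimage_mem_nhds h
      have h2 : ∀ᶠ p in 𝓝 (extChartAt I y z), p ∈ (extChartAt I y).target :=
        (ExtRechart.isOpen_extChartAt_target y).mem_nhds (hρt hqz)
      filter_upwards [h1, h2] with p hp hpt
      rw [hX₁ ⟨p, hpt⟩, hX₂ ⟨p, hpt⟩, mpullback_apply, mpullback_apply]
      exact congrArg _ hp
    have hGρ : ContDiffOn ℝ 2 G (ball (extChartAt I y y) (min r r₁)) := (hGa.mono hρr).of_le le_top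
    have heqX : EqOn X₁ X₂ (ball (extChartAt I y y) (min r r₁)) :=
      KillingAnalyticChart.eqOn_of_eventuallyEq isOpen_ball
        (convex_ball (extChartAt I y y) (min r r₁)).isPreconnected hGρ
        (fun z hz ↦ hGs z (hρr hz)) (fun z hz ↦ hGn z (hρr hz)) hX₁s hX₂s hX₁K hX₂K hqz hev
    -- back on `M`: `f₁ = f₂` on the chart neighbourhood of `y`
    have hagree : ∀ y' ∈ (extChartAt I y).source ∩ extChartAt I y ⁻¹' ball (extChartAt I y y)
        (min r r₁),
        f₁ y' = f₂ y' := by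
      rintro y' ⟨hy's, hy'b⟩
      obtain ⟨p, rfl⟩ := ExtChartKilling.exists_symm_eq y hy's
      have hpb : (p : E) ∈ ball (extChartAt I y y) (min r r₁) := by
        rwa [mem_preimage, ExtChartKilling.apply_symm] at hy'b
      rw [← ExtChartKilling.mpullback_extChartAt_repr_apply hX₁ p,
        ← ExtChartKilling.mpullback_extChartAt_repr_apply hX₂ p, mpullback_apply, mpullback_apply]
      refine congrArg _ ?_
      show X₁ (extChartAt I y ((extChartAt I y).symm p)) = X₂ (extChartAt I y ((extChartAt I
          y).symm p))
      rw [ExtChartKilling.apply_symm]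
      exact heqX hpb
    exact Filter.eventuallyEq_of_mem (hWo.mem_nhds hyW) hagree
  intro y hy
  exact (hsub hy).eq_of_nhds

/-! ### The good neighbourhoods: Nomizu's Theorem 1 on `M` -/

/-- **Nomizu's Theorem 1 on `M`.** Every point `x₀` has an open preconnected neighbourhood `W`
(the inverse image of the half chart ball) such that every field `C^∞` and Killing on an open set
through a point `y ∈ W` agrees near `y` with a field `C^∞` and Killing on `W` — read the field in
the chart (`exists_coord_solution`), extend it analytically over the chart ball
(`KillingAnalyticChart.exists_extension_of_mem_ball`), and bring the extension back
(`ExtChartKilling.killingOn_mpullback_extChartAt`). Nomizu 1960, Theorem 1.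
[cite: Nomizu1960, Theorem 1] -/
theorem exists_killing_extension_nhds (x₀ : M) :
    ∃ W : Set M, IsOpen W ∧ x₀ ∈ W ∧ IsPreconnected W ∧
      ∀ y ∈ W, ∀ (U : Set M) (f : Π x : M, TangentSpace I x), IsOpen U → y ∈ U →
        ContMDiffOn I I.tangent ∞ (fun x ↦ (TotalSpace.mk' E x (f x) : TangentBundle I M)) U →
        (∀ x ∈ U, ∀ v w : TangentSpace I x,
          g.val x (g.leviCivita f x v) w + g.val x v (g.leviCivita f x w) = 0) →
        ∃ f' : Π x : M, TangentSpace I x,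
          ContMDiffOn I I.tangent ∞ (fun x ↦ (TotalSpace.mk' E x (f' x) : TangentBundle I M)) W ∧
          (∀ x ∈ W, ∀ v w : TangentSpace I x,
            g.val x (g.leviCivita f' x v) w + g.val x v (g.leviCivita f' x w) = 0) ∧
          f =ᶠ[𝓝 y] f' := by
  obtain ⟨G, r, hr, hrt, hG, hGa, hGs, hGn⟩ := exists_chart_ball g x₀
  have hr2 : ball (extChartAt I x₀ x₀) (r / 2) ⊆ ball (extChartAt I x₀ x₀) r :=
    ball_subset_ball (by linarith)
  have hWo : IsOpen ((extChartAt I x₀).source ∩ extChartAt I x₀ ⁻¹' ball (extChartAt I x₀ x₀) (r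
      / 2)) :=
    isOpen_extChartAt_preimage' x₀ isOpen_ball
  have hx₀W : x₀ ∈ (extChartAt I x₀).source ∩ extChartAt I x₀ ⁻¹' ball (extChartAt I x₀ x₀) (r /
      2) :=
    ⟨mem_extChartAt_source x₀, mem_ball_self (half_pos hr)⟩
  have hWeq : (extChartAt I x₀).source ∩ extChartAt I x₀ ⁻¹' ball (extChartAt I x₀ x₀) (r / 2) =
      (extChartAt I x₀).symm '' ball (extChartAt I x₀ x₀) (r / 2) := by
    rw [← PartialEquiv.symm_image_target_inter_eq', inter_eq_right.mpr (hr2.trans hrt)]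
  have hWc : IsPreconnected
      ((extChartAt I x₀).source ∩ extChartAt I x₀ ⁻¹' ball (extChartAt I x₀ x₀) (r / 2)) := by
    rw [hWeq]
    exact (convex_ball _ _).isPreconnected.image _
      ((contMDiffOn_extChartAt_symm (n := ω) x₀).continuousOn.mono (hr2.trans hrt))
  refine ⟨_, hWo, hx₀W, hWc, fun y hy U f hU hyU hfs hfK ↦ ?_⟩
  -- the chart ball around `q = φ y` over `U`
  have hqc : extChartAt I x₀ y ∈ ball (extChartAt I x₀ x₀) (r / 2) := hy.2
  have hSo : IsOpen ((extChartAt I x₀).target ∩ (extChartAt I x₀).symm ⁻¹' U) :=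
    (contMDiffOn_extChartAt_symm (n := ω) x₀).continuousOn.isOpen_inter_preimage
      (ExtRechart.isOpen_extChartAt_target x₀) hU
  have hqS : extChartAt I x₀ y ∈ (extChartAt I x₀).target ∩ (extChartAt I x₀).symm ⁻¹' U :=
    ⟨(extChartAt I x₀).map_source hy.1, by
      rw [mem_preimage, (extChartAt I x₀).left_inv hy.1]; exact hyU⟩
  obtain ⟨r₁, hr₁, hr₁S⟩ := Metric.isOpen_iff.mp hSo _ hqS
  have hρ : 0 < min (r / 2) r₁ := lt_min (half_pos hr) hr₁
  have hρr : min (r / 2) r₁ ≤ r / 2 := min_le_left _ _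
  have hρt : ball (extChartAt I x₀ y) (min (r / 2) r₁) ⊆ (extChartAt I x₀).target :=
    fun z hz ↦ (hr₁S (ball_subset_ball (min_le_right _ _) hz)).1
  have hρU : ∀ z ∈ ball (extChartAt I x₀ y) (min (r / 2) r₁), (extChartAt I x₀).symm z ∈ U :=
    fun z hz ↦ (hr₁S (ball_subset_ball (min_le_right _ _) hz)).2
  obtain ⟨X, hX, hXs, hXK⟩ := exists_coord_solution g hG hU hfs hfK hρt hρU
  -- Nomizu's analytic extension in the chart
  obtain ⟨X', hX'a, hX'K, hX'eq⟩ :=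
    KillingAnalyticChart.exists_extension_of_mem_ball hGa hGs hGn hqc hρ hρr hXs hXK
  -- back to `M`
  obtain ⟨hF's, hF'K⟩ := ExtChartKilling.killingOn_mpullback_extChartAt g hG isOpen_ball
    (hX'a.of_le le_top) hX'K
  have hWsub : (extChartAt I x₀).source ∩ extChartAt I x₀ ⁻¹' ball (extChartAt I x₀ x₀) (r / 2) ⊆
      (extChartAt I x₀).source ∩ extChartAt I x₀ ⁻¹' ball (extChartAt I x₀ x₀) r :=
    fun y' hy' ↦ ⟨hy'.1, hr2 hy'.2⟩
  refine ⟨_, hF's.mono hWsub, fun y' hy' ↦ hF'K y' (hWsub hy'), ?_⟩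
  -- `f = f'` near `y`
  have hVo : IsOpen ((extChartAt I x₀).source ∩ extChartAt I x₀ ⁻¹' ball (extChartAt I x₀ y) (min
      (r / 2) r₁)) :=
    isOpen_extChartAt_preimage' x₀ isOpen_ball
  have hyV : y ∈ (extChartAt I x₀).source ∩ extChartAt I x₀ ⁻¹' ball (extChartAt I x₀ y) (min (r
      / 2) r₁) :=
    ⟨hy.1, mem_ball_self hρ⟩
  refine Filter.eventuallyEq_of_mem (hVo.mem_nhds hyV) ?_
  rintro y' ⟨hy's, hy'b⟩
  obtain ⟨p, rfl⟩ := ExtChartKilling.exists_symm_eq x₀ hy's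
  have hpb : (p : E) ∈ ball (extChartAt I x₀ y) (min (r / 2) r₁) := by
    rwa [mem_preimage, ExtChartKilling.apply_symm] at hy'b
  rw [← ExtChartKilling.mpullback_extChartAt_repr_apply hX p, mpullback_apply, mpullback_apply]
  refine congrArg _ ?_
  show X (extChartAt I x₀ ((extChartAt I x₀).symm p)) = X' (extChartAt I x₀ ((extChartAt I
      x₀).symm p))
  rw [ExtChartKilling.apply_symm]
  exact (hX'eq hpb).symm

/-! ### Locality -/

omit [FiniteDimensional ℝ E] [BoundarylessManifold I M] in
/-- A field which near every point agrees with a field `C^∞` and Killing on a neighbourhood is a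
global `C^∞` Killing field (smoothness and the covariant derivative are local,
`IsCovariantDerivativeOn.congr_of_eventuallyEq`). [folklore] -/
theorem killing_of_locally {F : Π x : M, TangentSpace I x}
    (h : ∀ x : M, ∃ U : Set M, IsOpen U ∧ x ∈ U ∧ ∃ f : Π x : M, TangentSpace I x,
      ContMDiffOn I I.tangent ∞ (fun x ↦ (TotalSpace.mk' E x (f x) : TangentBundle I M)) U ∧
      (∀ x ∈ U, ∀ v w : TangentSpace I x,
        g.val x (g.leviCivita f x v) w + g.val x v (g.leviCivita f x w) = 0) ∧
      EqOn F f U) :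
    ContMDiff I I.tangent ∞ (fun x ↦ (TotalSpace.mk' E x (F x) : TangentBundle I M)) ∧
      ∀ (x : M) (v w : TangentSpace I x),
        g.val x (g.leviCivita F x v) w + g.val x v (g.leviCivita F x w) = 0 := by
  have key : ∀ x : M, ContMDiffAt I I.tangent ∞
      (fun x ↦ (TotalSpace.mk' E x (F x) : TangentBundle I M)) x ∧
      ∀ v w : TangentSpace I x,
        g.val x (g.leviCivita F x v) w + g.val x v (g.leviCivita F x w) = 0 := by
    intro x
    obtain ⟨U, hU, hx, f, hfs, hfK, hFf⟩ := h x
    have hfx : ContMDiffAt I I.tangent ∞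
        (fun x ↦ (TotalSpace.mk' E x (f x) : TangentBundle I M)) x := hfs.contMDiffAt
            (hU.mem_nhds hx)
    have hev : (fun y ↦ (TotalSpace.mk' E y (F y) : TangentBundle I M)) =ᶠ[𝓝 x]
        fun y ↦ (TotalSpace.mk' E y (f y) : TangentBundle I M) :=
      Filter.eventuallyEq_of_mem (hU.mem_nhds hx) fun y hy ↦ by rw [hFf hy]
    have hFx : ContMDiffAt I I.tangent ∞
        (fun x ↦ (TotalSpace.mk' E x (F x) : TangentBundle I M)) x := hfx.congr_of_eventuallyEq hev
    refine ⟨hFx, fun v w ↦ ?_⟩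
    have hcov : g.leviCivita F x = g.leviCivita f x :=
      g.leviCivita.isCovariantDerivativeOnUniv.congr_of_eventuallyEq
        (hFx.mdifferentiableAt (by simp)) (hfx.mdifferentiableAt (by simp)) univ_mem
        (Filter.eventuallyEq_of_mem (hU.mem_nhds hx) hFf)
    rw [hcov]
    exact hfK x hx v w
  exact ⟨fun x ↦ (key x).1, fun x ↦ (key x).2⟩

end NomizuProof

/-! ### Local path-connectedness of the manifold -/

/-- A charted space over a real model with corners is locally path connected (`range I` is
convex; copy of the tree's `locallyPathConnectedSpace_of_modelWithCorners`,
`Literature/Topology/FourManifolds/SmoothOrientationProofs.lean`, kept private to keep the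
four-manifold files out of the import cone). [folklore] -/
private theorem locallyPathConnectedSpace_of_model {E : Type u} [NormedAddCommGroup E]
    [NormedSpace ℝ E] {H : Type v} [TopologicalSpace H] (I : ModelWithCorners ℝ E H)
    (M : Type w) [TopologicalSpace M] [ChartedSpace H M] : LocallyPathConnectedSpace M := by
  have : LocallyPathConnectedSpace (range I) := I.convex_range.locallyPathConnectedSpace
  have : LocallyPathConnectedSpace H :=
    I.isClosedEmbedding.isEmbedding.toHomeomorph.isOpenEmbedding.locallyPathConnectedSpace
  exact ChartedSpace.locallyPathConnectedSpace H M

/-! ### Nomizu's theorem -/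

/-- **DISCHARGE of `Nomizu1960_killing_extension` (Nomizu 1960, Thms. 1–2; pseudo-Riemannian form:
Chruściel 1997, Thm. 2.1): on a simply connected real-analytic pseudo-Riemannian manifold every
Killing field defined on a connected open subset extends to a global Killing field.** Proof
(Nomizu 1960; the analytic-continuation scheme of Kobayashi–Nomizu I, Ch. VI, Thm. 6.1): the local
Killing fields of `g` (`C^∞` sections satisfying the Killing equation on open sets) form a sheaf of
functions with unique continuation (`killing_eqOn_of_eventuallyEq`) and Nomizu's local extension
property on chart balls (`exists_killing_extension_nhds`, through the chart analysis
`KillingAnalyticChart.exists_extension_of_mem_ball`: the Killing transport system along rays has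
real-analytic coefficients, so its solutions give an analytic candidate whose Killing expression
vanishes identically by the identity theorem); on the simply connected, locally path connected `M`
the monodromy theorem for such sheaves
(`Literature.Topology.CoveringSpaces.exists_extension_of_simplyConnected`, via the covering space
of germs and Mathlib's `IsCoveringMap.existsUnique_continuousMap_lifts`) extends the given field
from the connected open set `𝒪` to all of `M`. [cite: Chrusciel1997, Thm. 2.1 (Nomizu)]
[cite: Nomizu1960, Theorems 1–2] -/
theorem Nomizu1960_killing_extension_holds : Nomizu1960_killing_extension := by
  intro E _ _ _ H _ I M _ _ _ _ _ _ _ g _ 𝒪 Y h𝒪 h𝒪c hYs hYK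
  haveI : LocallyPathConnectedSpace M := locallyPathConnectedSpace_of_model I M
  obtain ⟨F, hF, hFeq⟩ :=
    Literature.Topology.CoveringSpaces.exists_extension_of_simplyConnected (M := M) (V := E)
      (fun U f ↦ IsOpen U ∧
        ContMDiffOn I I.tangent ∞ (fun x ↦ (TotalSpace.mk' E x (f x) : TangentBundle I M)) U ∧
        ∀ x ∈ U, ∀ v w : TangentSpace I x,
          g.val x (g.leviCivita f x v) w + g.val x v (g.leviCivita f x w) = 0)
      (fun U U' f hf hU' hsub ↦ ⟨hU', hf.2.1.mono hsub, fun x hx ↦ hf.2.2 x (hsub hx)⟩)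
      (fun U f f' hU hUc hf hf' x hx heq ↦
        killing_eqOn_of_eventuallyEq g hU hUc hf.2.1 hf.2.2 hf'.2.1 hf'.2.2 hx heq)
      (fun x₀ ↦ by
        obtain ⟨W, hWo, hx₀, hWc, hext⟩ := exists_killing_extension_nhds g x₀
        refine ⟨W, hWo, hx₀, hWc, fun y hy U f hU hyU hf ↦ ?_⟩
        obtain ⟨f', h1, h2, h3⟩ := hext y hy U f hU hyU hf.2.1 hf.2.2
        exact ⟨f', ⟨hWo, h1, h2⟩, h3⟩)
      (fun F hF ↦ by
        obtain ⟨h1, h2⟩ := killing_of_locally g (F := F) fun x ↦ by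
          obtain ⟨U, hU, hx, f, hf, hFf⟩ := hF x
          exact ⟨U, hU, hx, f, hf.2.1, hf.2.2, hFf⟩
        exact ⟨isOpen_univ, h1.contMDiffOn, fun x _ v w ↦ h2 x v w⟩)
      h𝒪 h𝒪c ⟨h𝒪, hYs, hYK⟩
  exact ⟨F, contMDiffOn_univ.mp hF.2.1, fun x v w ↦ hF.2.2 x (mem_univ x) v w, hFeq⟩

end PseudoRiemannianMetric

end Literature.Geometry.Lorentzian

end
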